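import Literature.Computability.Complexity.LazySamplingMachine
import HarnessLib

/-!
# `FP^∅ = FP`, and an `FP` oracle gives no power (`FP^h ⊆ FP`, `P^h ⊆ P` for `h ∈ FP`)

Topic `Literature/Computability/Complexity`; companion of `OracleEmpty.lean` (which proves the
LANGUAGE form `P^∅ = P`, `PRel_empty_holds`). Here the same clocked-iteration simulation is carried
out for oracle algorithms with STRING outputs (`OracleAlg (List Bool)`, the machines of the function
class `FPRel O = FP^O` of `Oracle.lean`):

* `FPRel_empty_subset_FP`, `FPRel_empty_eq` — **`FP^∅ = FP`** (Baker–Gill–Solovay 1975, §1: the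
  empty oracle gives no power; function-class form);
* `FPRel_subset_FP_of_mem_FP` — **`h ∈ FP ⟹ FP^h ⊆ FP`**: a polynomial-time oracle machine whose
  oracle is itself a polynomial-time FUNCTION computes a polynomial-time function (Arora–Barak 2009,
  §3.4, Example 3.6 (2) "if `O ∈ P` then `P^O = P`", in the function form of §17.2; composed from the
  tree's `FP^h ⊆ FP^∅` for `h ∈ FP ⊆ FP^∅`, `OracleAlg.FPRel_subset_FPRel_of_mem_FPRel` and
  `OracleAlg.FP_subset_FPRel_core`, and `FP^∅ ⊆ FP` above);
* `PRel_subset_P_of_mem_FP` — the language form **`h ∈ FP ⟹ P^h ⊆ P`** (named; the tree used it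
  inline, e.g. `OracleAlg.lazyLang_mem_P`).

These are the extraction lemmas needed whenever a reduction SIMULATES an oracle adversary, answering
its queries by a polynomial-time rule, and must output a STRING (a preimage, a collision, a forged
signature) rather than a bit — e.g. the inverter built from a one-time forger in Lamport's
construction (Goldreich 2004, Prop. 6.4.5), the collision finder of one-time hash-and-sign
(Prop. 6.4.31) and the one-time forger of the authentication-tree reduction (Prop. 6.4.15).

## The simulation

For `f ∈ FP^∅` computed by `M : OracleAlg (List Bool)` within `q(|x|)` rounds, every answer of the
empty oracle is the constant `encodeBool false = [0]`, so the interaction is the `q(|x|)`-fold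
iteration of the closed round `simStep M (x, answers) = (x, answers ++ [[0]])` (query) / `= (x,
answers)` (output), followed by one more evaluation of the step function and dropping the tag bit of
its encoded result `1·b` (`PrePost.tailT`). The round is assembled exactly as in `OracleEmpty.lean`
(duplicate the state, run the step machine on the first copy with the second as context —
`PolyTimeComputable.firstField` —, then the transducers `EmptySim.headT`, `EmptySim.updT`, `swapFn`,
`EmptySim.concatT`), each round adding at most `6` symbols, so the clocked-iteration combinator
`PolyTimeComputable.iterate_of_le_add` applies with the input preparation `EmptySim.polyTime_prep`.
No Turing machine is programmed.

## References

* T. Baker, J. Gill, R. Solovay, *Relativizations of the P =? NP question*, SIAM J. Comput. 4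
  (1975) 431–442, §1.
* S. Arora, B. Barak, *Computational Complexity: A Modern Approach*, CUP 2009, §3.4 (oracle
  machines), Example 3.6 (2), §17.2 (`FP^O`), §1.4.1 (clocked simulation).
* O. Goldreich, *Foundations of Cryptography II: Basic Applications*, CUP 2004, §6.4.1–6.4.2
  (Props. 6.4.5, 6.4.15, 6.4.31: reductions that run a forger as a subroutine), as consumers.
-/

namespace Literature.Computability.Complexity

open _root_.Computability

namespace EmptySimFP

open EmptySim (St)

/-! ### The one-round map for string-output algorithms and its correctness -/

/-- **One round against the empty oracle** (string-output algorithms): a query is answered by the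
constant `[0]` (`Oracle.empty_apply`), an output freezes the state. [Baker–Gill–Solovay 1975, §1]
[cite: BakerGillSolovay1975, §1] -/
def simStep (M : OracleAlg (List Bool)) (p : St) : St :=
  match M.step p.1 p.2 with
  | Sum.inl _ => (p.1, p.2 ++ [[false]])
  | Sum.inr _ => p

/-- The output read off a state: the output string of `M` if its step is an output, the query
(documented junk value) otherwise. [folklore] -/
def simOut (M : OracleAlg (List Bool)) (p : St) : List Bool :=
  match M.step p.1 p.2 with
  | Sum.inl q => q
  | Sum.inr b => b

/-- **Correctness of the simulation**: if the run of `M` against `∅` from the transcript `as`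
outputs `b` within `k` rounds, then `k` rounds of `simStep` from `(x, as)` reach a state whose
output is `b`. [Baker–Gill–Solovay 1975, §1] [cite: BakerGillSolovay1975, §1] -/
theorem simOut_iterate (M : OracleAlg (List Bool)) (x : List Bool) {k : ℕ} {as : List (List Bool)}
    {b : List Bool} (h : M.runAux Oracle.empty x k as = some b) :
    simOut M ((simStep M)^[k] (x, as)) = b := by
  induction k generalizing as with
  | zero => simp at h
  | succ k ih =>
    rw [OracleAlg.runAux_succ] at h
    cases hs : M.step x as with
    | inl q =>
      rw [hs] at h
      dsimp only at h
      have hF : simStep M (x, as) = (x, as ++ [[false]]) := by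
        simp only [simStep, hs]
      rw [Function.iterate_succ_apply, hF]
      apply ih
      have he : Oracle.empty q = [false] := by rw [Oracle.empty_apply]; rfl
      rwa [he] at h
    | inr b' =>
      rw [hs] at h
      dsimp only at h
      simp only [Option.some.injEq] at h
      subst h
      have hF : simStep M (x, as) = (x, as) := by simp only [simStep, hs]
      rw [Function.iterate_fixed hF]
      simp only [simOut, hs]

/-- Each round adds one constant answer: the encoded state grows by at most `6` symbols
(`|⟨x, listBool (as ++ [[0]])⟩| = |⟨x, listBool as⟩| + 6`). [folklore] -/
theorem length_encIn_simStep_le (M : OracleAlg (List Bool)) (p : St) :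
    (OracleAlg.encIn (simStep M p)).length ≤ (OracleAlg.encIn p).length + 6 := by
  obtain ⟨x, as⟩ := p
  unfold simStep
  cases M.step x as with
  | inr _ => simp
  | inl _ =>
    dsimp only
    rw [show OracleAlg.encIn (x, as ++ [[false]]) =
        boolPair x ((encodingList Bool).listBool.encode (as ++ [[false]])) from rfl,
      EmptySim.listBool_encode_append_singleton,
      show OracleAlg.encIn (x, as) = boolPair x ((encodingList Bool).listBool.encode as) from rfl]
    simp only [length_boolPair, List.length_cons, List.length_append, List.length_nil]
    have : ((encodingList Bool).encode [false]).length = 1 := rfl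
    omega

/-! ### The polynomial-time stages of the round -/

/-- Field encoding of (step result, state as context), string outputs. [folklore] -/
def encB (q : (List Bool ⊕ List Bool) × St) : List (Option Bool) :=
  (OracleAlg.encOut q.1).map some ++ none :: (OracleAlg.encIn q.2).map some

/-- Stage C of the round: forget the query, append the constant answer; or freeze. [folklore] -/
def stageC (q : (List Bool ⊕ List Bool) × St) : St :=
  match q.1 with
  | Sum.inl _ => (q.2.1, q.2.2 ++ [[false]])
  | Sum.inr _ => q.2

/-- The round factors as duplicate ▸ step on the first copy ▸ stage C. [folklore] -/
theorem simStep_eq_comp (M : OracleAlg (List Bool)) :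
    simStep M = stageC ∘ Prod.map (Function.uncurry M.step) id ∘ fun p : St => (p, p) := by
  funext p
  obtain ⟨x, as⟩ := p
  simp only [Function.comp_apply, Prod.map_apply, id, Function.uncurry_apply_pair, stageC,
    simStep]

/-- **Stage B is polynomial-time**: the step machine of `M` on the first field
(`PolyTimeComputable.firstField`). [Arora–Barak 2009, §1.3] [cite: AroraBarak2009, §1.3 and Claim 1.6] -/
theorem polyTime_stageB {M : OracleAlg (List Bool)} (hM : M.IsPolyTime (encodingList Bool)) :
    PolyTimeComputable EmptySim.encA encB (Prod.map (Function.uncurry M.step) id) :=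
  PolyTimeComputable.firstField (fun p : St => (OracleAlg.encIn p).map some) hM

/-- **Stage C is polynomial-time**: `fromField`, keep the tag (`headT`), `updT`, `swapFn`,
`concatT` — verbatim the stage of `OracleEmpty.lean`, the tag bit being all that is read of the
step result. [Arora–Barak 2009, §1.3] [cite: AroraBarak2009, §1.3 and Claim 1.6] -/
theorem polyTime_stageC : PolyTimeComputable encB OracleAlg.encIn stageC := by
  have hW : (EmptySim.concatT.eval ∘ swapFn ∘ EmptySim.updT.eval ∘ mapFstFn EmptySim.headT.eval) ∈ FP :=
    comp_mem_FP EmptySim.concatT.polyTimeComputable_eval (comp_mem_FP swapFn_mem_FP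
      (comp_mem_FP EmptySim.updT.polyTimeComputable_eval
        (mapFstFn_mem_FP EmptySim.headT.polyTimeComputable_eval)))
  have hS : PolyTimeComputable (id : List (Option Bool) → _) (id : List Bool → List Bool)
      ((EmptySim.concatT.eval ∘ swapFn ∘ EmptySim.updT.eval ∘ mapFstFn EmptySim.headT.eval) ∘
        PrePost.fromField.eval) :=
    PolyTimeComputable.comp_holds hW PrePost.fromField.polyTimeComputable_eval
  refine PolyTimeComputable.of_encode hS encB (fun _ => rfl) fun q => ?_
  obtain ⟨r, x, as⟩ := q
  cases r with
  | inr b =>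
    simp only [id, Function.comp_apply, encB, stageC, OracleAlg.encOut_inr, PrePost.fromField_eval,
      mapFstFn_boolPair, EmptySim.headT_eval_cons, EmptySim.updT_eval_true, swapFn_boolPair,
      EmptySim.concatT_eval, List.append_nil]
  | inl y =>
    simp only [id, Function.comp_apply, encB, stageC, OracleAlg.encOut_inl, PrePost.fromField_eval,
      mapFstFn_boolPair, EmptySim.headT_eval_cons]
    rw [show OracleAlg.encIn (x, as) = boolPair x ((encodingList Bool).listBool.encode as) from rfl,
      EmptySim.updT_eval_false, swapFn_boolPair, EmptySim.concatT_eval,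
      show OracleAlg.encIn (x, as ++ [[false]]) =
        boolPair x ((encodingList Bool).listBool.encode (as ++ [[false]])) from rfl,
      EmptySim.listBool_encode_append_singleton]
    simp [boolPair, List.append_assoc]

/-- **The round `simStep M` is polynomial-time** on encoded states. [Arora–Barak 2009, §1.3, §3.4]
[cite: AroraBarak2009, §3.4 Example 3.6 (2)] -/
theorem polyTime_simStep {M : OracleAlg (List Bool)} (hM : M.IsPolyTime (encodingList Bool)) :
    PolyTimeComputable OracleAlg.encIn OracleAlg.encIn (simStep M) := by
  rw [simStep_eq_comp]
  exact PolyTimeComputable.comp_holds polyTime_stageC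
    (PolyTimeComputable.comp_holds (polyTime_stageB hM) EmptySim.polyTime_stageA)

/-- **Reading off the output string is polynomial-time**: drop the tag bit (`PrePost.tailT`):
`encOut (inr b) = 1b ↦ b`, `encOut (inl q) = 0q ↦ q`. [folklore] -/
theorem polyTime_out :
    PolyTimeComputable OracleAlg.encOut (id : List Bool → List Bool)
      (fun r : List Bool ⊕ List Bool => match r with | Sum.inl q => q | Sum.inr b => b) := by
  refine PolyTimeComputable.of_encode PrePost.tailT.polyTimeComputable_eval OracleAlg.encOut
    (fun _ => rfl) fun r => ?_
  cases r with
  | inl y => simp only [id, OracleAlg.encOut_inl, PrePost.tailT_eval_cons]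
  | inr b => simp only [id, OracleAlg.encOut_inr, PrePost.tailT_eval_cons]

end EmptySimFP

/-- **`FP^∅ ⊆ FP`**: a string function computed relative to the empty oracle within `q(|x|)`
rounds is computed by the polynomial-time machine "prepare the clock, iterate `simStep M` `q(|x|)`
times (`PolyTimeComputable.iterate_of_le_add`, growth `6` per round), run the step once more and drop
the tag bit" (`EmptySimFP.simOut_iterate`). [Baker–Gill–Solovay 1975, §1]
[cite: BakerGillSolovay1975, §1] -/
theorem FPRel_empty_subset_FP : FPRel Oracle.empty ⊆ FP := by
  intro f hf
  obtain ⟨M, hM, q, hq⟩ := hf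
  -- the clocked iteration of the round
  have hIt : PolyTimeComputable
      (fun s : EmptySim.St × ℕ => List.replicate s.2 none ++ (OracleAlg.encIn s.1).map some)
      OracleAlg.encIn (fun s => (EmptySimFP.simStep M)^[s.2] s.1) :=
    PolyTimeComputable.iterate_of_le_add 6 (EmptySimFP.length_encIn_simStep_le M)
      (EmptySimFP.polyTime_simStep hM)
  have h3 : PolyTimeComputable (id : List Bool → List Bool) OracleAlg.encIn
      (fun x => (EmptySimFP.simStep M)^[q.eval x.length] ((x, []) : EmptySim.St)) :=
    PolyTimeComputable.comp_holds hIt (EmptySim.polyTime_prep q)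
  have h4 : PolyTimeComputable (id : List Bool → List Bool) OracleAlg.encOut
      (Function.uncurry M.step ∘
        fun x => (EmptySimFP.simStep M)^[q.eval x.length] ((x, []) : EmptySim.St)) :=
    PolyTimeComputable.comp_holds hM h3
  have h5 := PolyTimeComputable.comp_holds EmptySimFP.polyTime_out h4
  refine PolyTimeComputable.of_encode h5 id (fun _ => rfl) fun x => ?_
  -- correctness: the read-off output is `f x`
  have hrun : M.runAux Oracle.empty x (q.eval x.length) [] = some (f x) := (hq x).1
  exact congrArg id (EmptySimFP.simOut_iterate M x hrun)

/-- **`FP^∅ = FP`** (`FPRel_empty_subset_FP` and the query-free embedding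
`OracleAlg.FP_subset_FPRel_core`). [Baker–Gill–Solovay 1975, §1] [cite: BakerGillSolovay1975, §1] -/
theorem FPRel_empty_eq : FPRel Oracle.empty = FP :=
  Set.Subset.antisymm FPRel_empty_subset_FP (OracleAlg.FP_subset_FPRel_core Oracle.empty)

/-- **A polynomial-time function oracle gives no power, function form: `h ∈ FP ⟹ FP^h ⊆ FP`.**
(`h ∈ FP ⊆ FP^∅`, so `FP^h ⊆ FP^∅ = FP` by `OracleAlg.FPRel_subset_FPRel_of_mem_FPRel`.) This is
the extraction step of every reduction that runs an oracle adversary as a subroutine, answers its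
queries by a polynomial-time rule and outputs a string. [Arora–Barak 2009, §3.4 Example 3.6 (2),
§17.2; Ladner–Lynch–Selman 1975, §2] [cite: AroraBarak2009, §3.4 Example 3.6 (2)] -/
theorem FPRel_subset_FP_of_mem_FP {h : Oracle} (hh : h ∈ FP) : FPRel h ⊆ FP := fun _ hf =>
  FPRel_empty_subset_FP
    (OracleAlg.FPRel_subset_FPRel_of_mem_FPRel (OracleAlg.FP_subset_FPRel_core Oracle.empty hh) hf)

/-- **A polynomial-time function oracle gives no power, language form: `h ∈ FP ⟹ P^h ⊆ P`.**
(`P^h ⊆ P^∅ = P` by `OracleAlg.PRel_subset_PRel_of_mem_FPRel` and `PRel_empty_holds`.)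
[Arora–Barak 2009, §3.4 Example 3.6 (2); Baker–Gill–Solovay 1975, §1]
[cite: AroraBarak2009, §3.4 Example 3.6 (2)] -/
theorem PRel_subset_P_of_mem_FP {h : Oracle} (hh : h ∈ FP) : PRel h ⊆ Classes.P := by
  have h1 : PRel h ⊆ PRel Oracle.empty :=
    OracleAlg.PRel_subset_PRel_of_mem_FPRel (OracleAlg.FP_subset_FPRel_core Oracle.empty hh)
  have h2 := PRel_empty_holds
  unfold PRel_empty at h2
  rwa [h2] at h1

end Literature.Computability.Complexity
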